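/-
Copyright: statement-level skeleton of a published paper (lit-balaban cell, Phase-2 proof seat p19, gen 4). No claims beyond
what the kernel checks below.
-/
import Mathlib
import Literature.MathematicalPhysics.QuantumFieldTheory.Balaban1983to89.B3AmpIBPAll
import Literature.MathematicalPhysics.QuantumFieldTheory.Balaban1983to89.B3Prop21Uniform

/-!
# B3 — T. Bałaban, *(Higgs)₂,₃ quantum fields in a finite volume. III. Renormalization*, CMP **88** (1983) 411–445
[Balaban1983Higgs3] — Sect. 2, p. 425: the single-line components `G₁, G₂^{(2)}, G₃^{(3)}, …` along an ordering (the
SITES of the integration by parts (2.8)/(2.9)) and the (2.4)-blocks, on the count data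

statement-level skeleton of published theorems with citation tags; proofs where landed; nothing here is a claim about
the Yang–Mills mass gap

PDF held: `paper:balaban1983-higgs-2-3-quantum-fields-finite-volume` (journal page = PDF page + 410); the sentences of
pp. 425–426 read on the ×2 renders `pub-balaban/b2b-balaban-ref1/pages/1983-cmp88-higgs23-III/1983-cmp88-higgs23-III-p015,
p016-x2.png`.

Part of the Phase-2 work on SKELETON rows **B3.Prop2.1 / B3.Prop2.2** (unit `lit-balaban-p19` gen 4, HOME
`run/shared/lean/pub/lit-balaban/`): the (2.4) EXCEPTION of Proposition 2.1, files `B3LatticeIBP` → `B3AmpIBP` →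
`B3AmpIBPClosed` → `B3AmpIBPAll` → `B3IBPSites` (this file) → `B3IBPDegrees` → `B3AmpIBPBounds` → `B3Prop21Except24`; over the count data
`B3Ineq215.Counts` (gen 2) and their blocks `G_i` (`B3Ineq215Quotient`), the ℚ-degrees `degQ` (`B3Prop21Instance`).

WHAT IS REPRODUCED.  p. 425 [PDF 15], verbatim: *"According to the assumption of the theorem, we have that either D(G_i^{(α)})
> 0, or G_i^{(α)} is the graph (2.4). Thus there is a possibility that the first few graphs G₁, G₂^{(2)}, G₃^{(3)}, … are
graphs (2.4) (let us notice that G₂ = G₁∪G₂^{(2)}, G₃ = G₁∪G₂^{(2)}∪G₃^{(3)}, …). … The effect of this transformation is that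
the graphs (2.4) are replaced by the graphs with degree +1. … Further let us notice that if the graph (2.4) is a subgraph
of some graph G₀, then after the transformation (2.9) G₀ is represented as a sum of three graphs and the degrees of these
graphs are ≧ D(G₀). It is so because the degrees of the vertices on the right side of (2.8) or (2.9) are bigger or equal to
the degree of the left side. From this it follows that for each graph G′∗ the subgraphs G₁, G₂, …, G_m = G′∗ defined as
previously have positive degrees."*  KERNEL-CHECKED HERE, on the count data: the SITES along the order of the lines (`sites G`): the lines `l` with `s(l) ≠ t(l)`, a differentiation of `s(l)` acting
  on `l`, and ISOLATED at their own stage — the component of `G_{l}` containing `l` is the single line `l` (`Isolated`); the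
  (2.4)-blocks `Is24Block` (a component of some `G_i` which is a single such line and has degree `0`) are single sites
  (`Is24Block.exists_site`); sites are pairwise vertex-disjoint and the other lines at a site's endpoints come later
  (`lt_of_touches`, `sites_isSiteSet` — the hypotheses of `B3AmpIBPAll.rawE_allSites`);
-/

open Finset

namespace Literature.MathematicalPhysics.QuantumFieldTheory.Balaban1983to89.B3Ineq213

open B3Ineq215

variable {V : Type} [Fintype V] [DecidableEq V] {m : ℕ}

/-! ## Sites along the order of the lines -/

/-- The line `l` is ISOLATED at its own stage: the component of `G_{l+1}` (lines `l(1), …, l` = indices `≤ l`) containing it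
consists of `l` alone — the single-line components `G₁, G₂^{(2)}, G₃^{(3)}, …` of p. 425. [cite: Balaban1983Higgs3, (2.9) p.425] -/
def Isolated (G : Counts V m) (l : Fin m) : Prop :=
  G.toModel.before ((l : ℕ) + 1) (G.toModel.bs l l.isLt) = {l}

/-- A SITE of the integration by parts: a line with two different endpoints, a differentiation of its first endpoint acting
on it (to be moved), isolated at its own stage. [cite: Balaban1983Higgs3, (2.8) p.425] -/
def IsSite (G : Counts V m) (l : Fin m) : Prop :=
  G.src l ≠ G.tgt l ∧ 1 ≤ G.diffOn (G.src l) l ∧ Isolated G l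

/-- Isolation is decidable (an equality of finite sets). [cite: Balaban1983Higgs3, (2.9) p.425] -/
noncomputable instance (G : Counts V m) (l : Fin m) : Decidable (Isolated G l) := inferInstanceAs (Decidable (_ = _))

/-- Being a site is decidable. [cite: Balaban1983Higgs3, (2.8) p.425] -/
noncomputable instance (G : Counts V m) (l : Fin m) : Decidable (IsSite G l) :=
  inferInstanceAs (Decidable (_ ∧ _ ∧ _))

/-- The set of sites of `G` (in the order of its lines). [cite: Balaban1983Higgs3, (2.8) p.425] -/
noncomputable def sites (G : Counts V m) : Finset (Fin m) := univ.filter fun l => IsSite G l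

/-- Membership in `sites`. [cite: Balaban1983Higgs3, (2.8) p.425] -/
theorem mem_sites {G : Counts V m} {l : Fin m} : l ∈ sites G ↔ IsSite G l := by simp [sites]

/-- A block which is a single line at some stage is that line's own-stage block: the line is isolated.
[cite: Balaban1983Higgs3, (2.9) p.425] -/
theorem isolated_of_before_eq {G : Counts V m} {i : ℕ} {b : V} {l : Fin m} (h : G.toModel.before i b = {l}) :
    Isolated G l := by
  have hl : l ∈ G.toModel.before i b := by rw [h]; exact mem_singleton_self _
  obtain ⟨hli, hlb⟩ := G.toModel.mem_before.1 hl
  unfold Isolated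
  ext p
  rw [G.toModel.mem_before, mem_singleton]
  constructor
  · rintro ⟨hp, hpb⟩
    have e : G.toModel.rep ((l : ℕ) + 1) (G.toModel.src p) = G.toModel.rep ((l : ℕ) + 1) (G.toModel.src l) := by
      rw [hpb, G.toModel.rep_succ_src l.isLt]
    have e' := G.toModel.rep_eq_of_le (Nat.succ_le_of_lt hli) e
    have hp' : p ∈ G.toModel.before i b := G.toModel.mem_before.2 ⟨lt_of_lt_of_le hp (Nat.succ_le_of_lt hli), by
      rw [e']; exact hlb⟩
    rw [h] at hp'
    exact mem_singleton.1 hp'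
  · rintro rfl
    exact ⟨Nat.lt_succ_self _, G.toModel.rep_succ_src _⟩

/-- **The other lines at an isolated line's endpoints come later** in the order. [cite: Balaban1983Higgs3, (2.9) p.425] -/
theorem lt_of_touches {G : Counts V m} {l p : Fin m} (hl : Isolated G l) (hp : p ≠ l)
    (ht : G.src p = G.src l ∨ G.tgt p = G.src l ∨ G.src p = G.tgt l ∨ G.tgt p = G.tgt l) : l < p := by
  by_contra hle
  have hpl : (p : ℕ) < (l : ℕ) + 1 := Nat.lt_succ_of_le (not_lt.1 hle)
  have hends : ∀ w, (w = G.src l ∨ w = G.tgt l) → G.toModel.rep ((l : ℕ) + 1) w = G.toModel.bs l l.isLt := by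
    rintro w (rfl | rfl)
    · exact G.toModel.rep_succ_src l.isLt
    · exact G.toModel.rep_succ_tgt l.isLt
  have hst : G.toModel.rep ((l : ℕ) + 1) (G.toModel.src p) = G.toModel.rep ((l : ℕ) + 1) (G.toModel.tgt p) :=
    G.toModel.rep_src_eq_rep_tgt hpl
  have hsrc : G.toModel.rep ((l : ℕ) + 1) (G.toModel.src p) = G.toModel.bs l l.isLt := by
    rcases ht with h | h | h | h
    · exact hends _ (Or.inl h)
    · rw [hst]; exact hends _ (Or.inl h)
    · exact hends _ (Or.inr h)
    · rw [hst]; exact hends _ (Or.inr h)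
  have hmem : p ∈ G.toModel.before ((l : ℕ) + 1) (G.toModel.bs l l.isLt) := G.toModel.mem_before.2 ⟨hpl, hsrc⟩
  unfold Isolated at hl
  rw [hl, mem_singleton] at hmem
  exact hp hmem

/-- **A line hit at a site vertex lies only in blocks containing the site**: if `p ≠ l` touches `s(l)` (an isolated `l`) and
`p` is a line of the block `b` of `G_i`, then so is `l`. [cite: Balaban1983Higgs3, (2.9) p.425] -/
theorem mem_before_of_hit {G : Counts V m} {l p : Fin m} (hl : Isolated G l) (hp : p ≠ l)
    (ht : G.src p = G.src l ∨ G.tgt p = G.src l) {i : ℕ} {b : V} (hpb : p ∈ G.toModel.before i b) :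
    l ∈ G.toModel.before i b := by
  obtain ⟨hpi, hpr⟩ := G.toModel.mem_before.1 hpb
  have hlp : l < p := lt_of_touches hl hp (by tauto)
  refine G.toModel.mem_before.2 ⟨lt_trans hlp hpi, ?_⟩
  have hst : G.toModel.rep i (G.toModel.src p) = G.toModel.rep i (G.toModel.tgt p) := G.toModel.rep_src_eq_rep_tgt hpi
  rcases ht with h | h
  · show G.toModel.rep i (G.src l) = b
    rw [← h]; exact hpr
  · show G.toModel.rep i (G.src l) = b
    rw [← h]
    exact hst ▸ hpr

/-- **The sites form a site set** (the hypotheses of `B3AmpIBPAll.rawE_allSites`): two different endpoints each, pairwise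
distinct site vertices, no site vertex an endpoint of another site line. [cite: Balaban1983Higgs3, (2.9) p.425] -/
theorem sites_isSiteSet (G : Counts V m) : IsSiteSet G.src G.tgt (sites G) := by
  refine ⟨fun l hl => (mem_sites.1 hl).1, fun l hl l' hl' hne h => ?_, fun l hl l' hl' hne h => ?_⟩
  · have h1 : l' < l := lt_of_touches (mem_sites.1 hl').2.2 hne (Or.inl h)
    have h2 : l < l' := lt_of_touches (mem_sites.1 hl).2.2 (Ne.symm hne) (Or.inl h.symm)
    exact lt_asymm h1 h2
  · have h1 : l' < l := lt_of_touches (mem_sites.1 hl').2.2 hne (Or.inr (Or.inr (Or.inl h)))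
    have h2 : l < l' := lt_of_touches (mem_sites.1 hl).2.2 (Ne.symm hne) (Or.inr (Or.inl h.symm))
    exact lt_asymm h1 h2

/-! ## The (2.4)-blocks -/

/-- **"G_i^{(α)} is the graph (2.4)"**, read on the count data: the component `b` of `G_i` has degree `0` and consists of a
single line with two different endpoints carrying a differentiation of its first endpoint (the derivative leg `D^η_B̃φ′` of the
vertex (1.8) contracted into the line). [cite: Balaban1983Higgs3, (2.4) p.424] -/
def Is24Block (G : Counts V m) (i : ℕ) (b : V) : Prop :=
  degQ G i b = 0 ∧ ∃ l : Fin m, G.src l ≠ G.tgt l ∧ 1 ≤ G.diffOn (G.src l) l ∧ G.toModel.before i b = {l}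

/-- A (2.4)-block is the block of a site. [cite: Balaban1983Higgs3, (2.9) p.425] -/
theorem Is24Block.exists_site {G : Counts V m} {i : ℕ} {b : V} (h : Is24Block G i b) :
    ∃ l ∈ sites G, G.toModel.before i b = {l} := by
  obtain ⟨-, l, h1, h2, h3⟩ := h
  exact ⟨l, mem_sites.2 ⟨h1, h2, isolated_of_before_eq h3⟩, h3⟩

end Literature.MathematicalPhysics.QuantumFieldTheory.Balaban1983to89.B3Ineq213
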